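import Mathlib
import Summits.NavierStokesRegularity.NavierStokesRegularity.Theorems.TaoLadderRungTwoFlatBehindTransport
import Summits.NavierStokesRegularity.NavierStokesRegularity.Theorems.TaoLadderRungTwoFlatZoneGeometry
import Summits.NavierStokesRegularity.NavierStokesRegularity.Theorems.TaoLadderRungTwoFlatNearHop
import HarnessLib

/-!
# The BEHIND-ZONE HOP under ruling R54-1: the block energies `behindEnergy K L θ′` of the re-centred landing state
  from the template-free transport inequality L-54b (helper for the K_A♭ parent item stmt-NavierStokesRegularity-22987
  `FlatGapCertificatesV2`, child 2A `GradedAdiabaticWakeA` of route TaoLadderRungTwoFlat; cell harvest/h2-tao-ladder, p1 g22;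
  theory-1 g42 ZONE-GEOMETRY-54 / LADDER §54, L-54e per block)

Under R54-1 the behind clause of `H(n)` is `R54.BehindEnergyClause K θ′ (W n) z` = every finite behind block
`[−K−L, −K−1]` of the state has `e^{θ′(k+K)}`-weighted energy `≤ W n`. Along one exact graded window flow `S` the block
of LANDING sites `[1−K−L, −K]` is fixed in absolute shells and its co-moving edge advances from `−K` to `1−K` over the
hop (`στ₁ = 1`), exactly as for the near zone (`…NearHop`), with template `0`: the transport inequality
`MirrorPulse.coMovingEnergyOn_transport_of_pseudoFlow` (L-54b) applies. This file is that per-block bookkeeping: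

* `coMovingEnergyOn_const_mul` — scaling `V(c·u) = c²·V(u)`;
* `behindEnergy_recentre` — `behindEnergy K L θ′ (recentre S τ₁ a) = a⁻²·V_{[1−K−L,−K]}^{1−K}(S)(τ₁)`;
* `behind_landing_of_energy` — `V_{[1−K−L,−K]}^{1−K}(S)(τ₁) ≤ a²·W′` ⇒ `behindEnergy K L θ′ (recentre S τ₁ a) ≤ W′`;
* `behind_hop_of_pseudoFlow` — THE HOP for one block (`L ≥ 1`): clock-weighted amplitude `A_eff` on the block's bonds,
  edge fluxes `≤ Ē_L` (bottom bond `−K−L`, top bond `−K`: the INPUT from the core, cubic in the two small interface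
  amplitudes), rate `0 < μ ≤ σθ′ − 2(1+ε)A_eff sinh(θ′/2)`, initial bound `V₀` and the budget
  `e^{−μτ₁}V₀ + Ē_L(1 − e^{−μτ₁})/μ ≤ a²W′` ⇒ `behindEnergy K L θ′ (recentre S τ₁ a) ≤ W′`; `behindEnergy_zero_depth` —
  the empty block `L = 0`;
* `behindEnergyClause_hop_of_pseudoFlow` — ALL BLOCKS AT ONCE (L-54e, block level): uniform clock-weighted bound on the
  behind bonds, per-block edge inputs `≤ Ē`, initial block energies `≤ V₀`, one budget ⇒ `BehindEnergyClause K θ′ W′ (recentre S τ₁ a)`;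
* `sqrt_initial_blockEnergy_le` — THE START: `√V₀ ≤ √(W n) + a_K + √L·r_k` from `BehindEnergyClause K θ′ (W n) z`,
  the amplitude `a_K` of the state at the window bottom `−K` (the deposit of the core's bottom shell into the block) and
  the kick `|S₀ − z| ≤ r_k` on the block.

HONEST FRAMING: inequalities about MODEL-lattice certificate flows (Tao 2016 §4 vocabulary, graded mirror table on `S♭`);
every bound is a HYPOTHESIS; nothing certified; no item closed; nothing about the Navier–Stokes equations.
-/

noncomputable section

-- the sub-problem namespace repeats the summit name by design (D-0017)
set_option linter.dupNamespace false

namespace Summit.NavierStokesRegularity.NavierStokesRegularity.Theorems.HopTube.R54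

open Set Finset Literature.Analysis.FluidPDE Literature.Analysis.FluidPDE.TaoCascade MirrorPulse

/-- Scaling of the co-moving energy: `V(c·u) = c²·V(u)`. [cite: Tao2016AveragedNS, §4 (4.3); route TaoLadderRungTwoFlat, re-centring by the ratio `a`] -/
theorem coMovingEnergyOn_const_mul (s : Finset ℤ) (θ ne c : ℝ) (u : Fin 2 → ℤ → ℝ → ℝ) (t : ℝ) :
    coMovingEnergyOn s θ ne (fun i k t => c * u i k t) t = c ^ 2 * coMovingEnergyOn s θ ne u t := by
  unfold coMovingEnergyOn
  rw [Finset.mul_sum]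
  refine Finset.sum_congr rfl fun k _ => ?_
  ring

/-- **The behind block energy of the re-centred state** is `a⁻²` times the co-moving energy of the flow itself on the
landing block `[1−K−L, −K]` with edge `1−K`. [cite: Tao2016AveragedNS, §6.4 (re-centring); route TaoLadderRungTwoFlat, R54-1 (LADDER §54)] -/
theorem behindEnergy_recentre (K L : ℕ) (θ' : ℝ) (S : Fin 2 → ℤ → ℝ → ℝ) (τ₁ a : ℝ) :
    behindEnergy K L θ' (recentre S τ₁ a)
      = (1 / a) ^ 2 * coMovingEnergyOn (Finset.Icc (1 - (K : ℤ) - L) (-(K : ℤ))) θ' (1 - (K : ℝ)) S τ₁ := by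
  unfold behindEnergy behindBlock
  have e1 : Finset.Icc (1 - (K : ℤ) - L) (-(K : ℤ)) = Finset.Icc (-(K : ℤ) - L + 1) (-(K : ℤ) - 1 + 1) := by
    congr 1 <;> ring
  have e2 : (1 - (K : ℝ)) = -(K : ℝ) + ((1 : ℤ) : ℝ) := by push_cast; ring
  rw [e1, e2, coMovingEnergyOn_Icc_shift, ← coMovingEnergyOn_const_mul]
  unfold coMovingEnergyOn
  refine Finset.sum_congr rfl fun k _ => ?_
  simp only [ofState_apply, recentre, add_comm k 1]
  ring

/-- **BEHIND LANDING FROM THE BLOCK ENERGY**: `V_{[1−K−L,−K]}^{1−K}(S)(τ₁) ≤ a²·W′` gives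
`behindEnergy K L θ′ (recentre S τ₁ a) ≤ W′`. [cite: Tao2016AveragedNS, §6.3–6.4 (statement shape); route TaoLadderRungTwoFlat, R54-1 (LADDER §54)] -/
theorem behind_landing_of_energy {K L : ℕ} {θ' : ℝ} {S : Fin 2 → ℤ → ℝ → ℝ} {τ₁ a W' : ℝ} (ha : 0 < a)
    (h : coMovingEnergyOn (Finset.Icc (1 - (K : ℤ) - L) (-(K : ℤ))) θ' (1 - (K : ℝ)) S τ₁ ≤ a ^ 2 * W') :
    behindEnergy K L θ' (recentre S τ₁ a) ≤ W' := by
  rw [behindEnergy_recentre K L θ' S τ₁ a]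
  have ha2 : 0 < a ^ 2 := by positivity
  rw [show (1 / a) ^ 2 = 1 / a ^ 2 by ring, one_div, ← div_eq_inv_mul, div_le_iff₀ ha2]
  linarith

/-- The depth-`0` block is empty: its energy is `0`. [cite: Tao2016AveragedNS, §4 (4.3); route TaoLadderRungTwoFlat, R54-1] -/
theorem behindEnergy_zero_depth (K : ℕ) (θ' : ℝ) (z : Fin 2 → ℤ → ℝ) : behindEnergy K 0 θ' z = 0 := by
  unfold behindEnergy behindBlock coMovingEnergyOn
  rw [Finset.Icc_eq_empty (by push_cast; omega), Finset.sum_empty]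

/-! ## The hop for one block -/

section Hop

variable {ε ε₀ τ κ₂ : ℝ} {S₀ F₀ B₀ : Fin 2 → ℤ → ℝ} {S F : Fin 2 → ℤ → ℝ → ℝ}

/-- **THE BEHIND-ZONE HOP FOR ONE BLOCK (`L ≥ 1`) along one exact graded window flow.** See the module docstring.
[cite: Tao2016AveragedNS, §4 (4.3), (4.8), §6.3–6.4 (statement shape); route TaoLadderRungTwoFlat, L-54b/L-54e (R54-1, LADDER §54)] -/
theorem behind_hop_of_pseudoFlow (hS : PseudoFlowOnShift shiftSetFlat τ ε₀ (mirrorTable ε ε) 0 κ₂ S₀ F₀ B₀ S F)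
    (hε : 0 ≤ ε) (hε₀ : -1 ≤ ε₀) {K L : ℕ} (hL : 1 ≤ L) {θ' σ τ₁ a Aeff μ Ebar V₀ W' : ℝ} (hθ : 0 ≤ θ')
    (hAeff : 0 ≤ Aeff) (hτ₁ : 0 < τ₁) (hτ₁τ : τ₁ ≤ τ) (hστ : σ * τ₁ = 1) (ha : 0 < a)
    (hbd : ∀ t ∈ Ioo 0 τ₁, ∀ n ∈ Finset.Icc (-(K : ℤ) - L) (-(K : ℤ)),
      clock ε₀ n * |S 1 n t| ≤ Aeff ∧ clock ε₀ n * |S 0 (n + 1) t| ≤ Aeff)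
    (hE : ∀ t ∈ Ioo 0 τ₁,
      Real.exp (θ' * ((((1 - (K : ℤ) - L : ℤ)) : ℝ) - (-(K : ℝ) + σ * t))) * |fluxT ε ε₀ S (1 - (K : ℤ) - L - 1) t|
        + Real.exp (θ' * ((((-(K : ℤ)) : ℤ) : ℝ) - (-(K : ℝ) + σ * t))) * |fluxT ε ε₀ S (-(K : ℤ)) t| ≤ Ebar)
    (hμ : 0 < μ) (hμle : μ ≤ σ * θ' - 2 * (1 + ε) * Aeff * Real.sinh (θ' / 2))
    (hV₀ : coMovingEnergyOn (Finset.Icc (1 - (K : ℤ) - L) (-(K : ℤ))) θ' (-(K : ℝ)) S 0 ≤ V₀)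
    (hbudget : Real.exp (-μ * τ₁) * V₀ + Ebar * (1 - Real.exp (-μ * τ₁)) / μ ≤ a ^ 2 * W') :
    behindEnergy K L θ' (recentre S τ₁ a) ≤ W' := by
  have haP : (1 - (K : ℤ) - L) ≤ -(K : ℤ) := by
    have : (1 : ℤ) ≤ L := by exact_mod_cast hL
    omega
  have hbd' : ∀ t ∈ Ioo 0 τ₁, ∀ n ∈ Finset.Icc (1 - (K : ℤ) - L - 1) (-(K : ℤ)),
      clock ε₀ n * |S 1 n t| ≤ Aeff ∧ clock ε₀ n * |S 0 (n + 1) t| ≤ Aeff := by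
    intro t ht n hn
    refine hbd t ht n ?_
    simp only [Finset.mem_Icc] at hn ⊢; omega
  have hdecay := coMovingEnergyOn_transport_of_pseudoFlow (θ := θ') (σ := σ) (n₀ := -(K : ℝ)) hS hε hε₀ hθ hAeff
    haP le_rfl hτ₁.le hτ₁τ hbd' hE hμ hμle
  have e1 : -(K : ℝ) + σ * τ₁ = 1 - (K : ℝ) := by linarith
  have e0 : -(K : ℝ) + σ * 0 = -(K : ℝ) := by ring
  rw [e1, e0, sub_zero] at hdecay
  have hexp0 : 0 ≤ Real.exp (-μ * τ₁) := (Real.exp_pos _).le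
  refine behind_landing_of_energy ha (hdecay.trans ?_)
  nlinarith [mul_le_mul_of_nonneg_left hV₀ hexp0]

end Hop

/-! ## The start: the initial block energy from `H(n)` -/

/-- **THE INITIAL BLOCK ENERGY (behind).** With `S(0) = S₀`, the (B1) clause `BehindEnergyClause K θ′ (W n) z` of the
tube state, its amplitude `a_K` at the window bottom `−K` (both species) and the kick `|S₀ − z| ≤ r_k` on the block:
`√V_{[1−K−L,−K]}^{−K}(S)(0) ≤ √(W n) + a_K + √L·r_k`.
[cite: Tao2016AveragedNS, §6.3–6.4 (statement shape); route TaoLadderRungTwoFlat, R54-1 schedule `W(n+1) ≤ e^{−θ′s}a⁻²W(n) + I_n` (LADDER §54.8)] -/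
theorem sqrt_initial_blockEnergy_le {K L : ℕ} {θ' Wn aK rk : ℝ} {z S₀ : Fin 2 → ℤ → ℝ}
    {S : Fin 2 → ℤ → ℝ → ℝ} (hS0 : ∀ i k, S i k 0 = S₀ i k) (hθ : 0 ≤ θ')
    (hW : BehindEnergyClause K θ' Wn z) (hWn : 0 ≤ Wn)
    (haK : ∀ i, |z i (-(K : ℤ))| ≤ aK)
    (hkick : ∀ i, ∀ k ∈ Finset.Icc (1 - (K : ℤ) - L) (-(K : ℤ)), |S₀ i k - z i k| ≤ rk) (hrk : 0 ≤ rk) :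
    Real.sqrt (coMovingEnergyOn (Finset.Icc (1 - (K : ℤ) - L) (-(K : ℤ))) θ' (-(K : ℝ)) S 0)
      ≤ Real.sqrt Wn + aK + Real.sqrt L * rk := by
  have haK0 : 0 ≤ aK := (abs_nonneg _).trans (haK 0)
  -- `√(x + y) ≤ √x + √y` (inlined)
  have hsqrt_add : ∀ {x y : ℝ}, 0 ≤ x → 0 ≤ y → Real.sqrt (x + y) ≤ Real.sqrt x + Real.sqrt y := by
    intro x y hx hy
    rw [Real.sqrt_le_left (by positivity)]
    nlinarith [Real.sq_sqrt hx, Real.sq_sqrt hy, Real.sqrt_nonneg x, Real.sqrt_nonneg y]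
  -- split `S₀ = z + (S₀ − z)` on the block
  have hsplit : coMovingEnergyOn (Finset.Icc (1 - (K : ℤ) - L) (-(K : ℤ))) θ' (-(K : ℝ)) S 0
      = coMovingEnergyOn (Finset.Icc (1 - (K : ℤ) - L) (-(K : ℤ))) θ' (-(K : ℝ))
          ((fun i k _ => z i k) + fun i k _ => S₀ i k - z i k) 0 := by
    refine coMovingEnergyOn_congr_at fun i k _ => ?_
    simp only [Pi.add_apply, hS0]
    ring
  -- piece 1: the state on the block = behind block of depth L−1 plus the shell −K
  have hE₁ : coMovingEnergyOn (Finset.Icc (1 - (K : ℤ) - L) (-(K : ℤ))) θ' (-(K : ℝ)) (fun i k _ => z i k) 0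
      ≤ Wn + aK ^ 2 := by
    by_cases hL : L = 0
    · subst hL
      unfold coMovingEnergyOn
      rw [Finset.Icc_eq_empty (by push_cast; omega), Finset.sum_empty]
      positivity
    have hL1 : 1 ≤ L := Nat.one_le_iff_ne_zero.mpr hL
    have h1L : (1 : ℤ) ≤ (L : ℤ) := by exact_mod_cast hL1
    have hsucc := coMovingEnergyOn_Icc_succ_le (a := 1 - (K : ℤ) - L) (P := -(K : ℤ) - 1) (θ := θ')
      (ne := -(K : ℝ)) (by omega) hθ (by push_cast; linarith)
      (fun i k _ => z i k) 0
    simp only [sub_add_cancel] at hsucc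
    have hblk : coMovingEnergyOn (Finset.Icc (1 - (K : ℤ) - L) (-(K : ℤ) - 1)) θ' (-(K : ℝ)) (fun i k _ => z i k) 0
        ≤ Wn := by
      have hsub : Finset.Icc (1 - (K : ℤ) - L) (-(K : ℤ) - 1) ⊆ behindBlock K L := by
        unfold behindBlock
        exact Finset.Icc_subset_Icc (by omega) le_rfl
      exact (coMovingEnergyOn_mono hsub θ' (-(K : ℝ)) _ 0).trans (hW L)
    have htop : ((fun (i : Fin 2) (k : ℤ) (_ : ℝ) => z i k) 0 (-(K : ℤ)) 0 ^ 2
        + (fun (i : Fin 2) (k : ℤ) (_ : ℝ) => z i k) 1 (-(K : ℤ)) 0 ^ 2) / 2 ≤ aK ^ 2 := by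
      have h0 : z 0 (-(K : ℤ)) ^ 2 ≤ aK ^ 2 := by
        rw [← sq_abs]; exact pow_le_pow_left₀ (abs_nonneg _) (haK 0) 2
      have h1 : z 1 (-(K : ℤ)) ^ 2 ≤ aK ^ 2 := by
        rw [← sq_abs]; exact pow_le_pow_left₀ (abs_nonneg _) (haK 1) 2
      linarith
    linarith
  -- piece 2: the kick on the block (weights ≤ 1, `L` shells)
  have hcard : ((Finset.Icc (1 - (K : ℤ) - L) (-(K : ℤ))).card : ℝ) ≤ L := by
    have h : (Finset.Icc (1 - (K : ℤ) - L) (-(K : ℤ))).card ≤ L := by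
      rw [Int.card_Icc]
      exact Int.toNat_le.mpr (by omega)
    exact_mod_cast h
  have hE₂ : coMovingEnergyOn (Finset.Icc (1 - (K : ℤ) - L) (-(K : ℤ))) θ' (-(K : ℝ)) (fun i k _ => S₀ i k - z i k) 0
      ≤ (L : ℝ) * rk ^ 2 := by
    unfold coMovingEnergyOn
    beta_reduce
    calc ∑ k ∈ Finset.Icc (1 - (K : ℤ) - L) (-(K : ℤ)), Real.exp (θ' * ((k : ℝ) - -(K : ℝ))) *
            (((S₀ 0 k - z 0 k) ^ 2 + (S₀ 1 k - z 1 k) ^ 2) / 2)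
        ≤ ∑ k ∈ Finset.Icc (1 - (K : ℤ) - L) (-(K : ℤ)), rk ^ 2 := by
          refine Finset.sum_le_sum fun k hk => ?_
          have hk' : k ≤ -(K : ℤ) := (Finset.mem_Icc.mp hk).2
          have hkR : (k : ℝ) ≤ -(K : ℝ) := by exact_mod_cast hk'
          have hw : Real.exp (θ' * ((k : ℝ) - -(K : ℝ))) ≤ 1 :=
            Real.exp_le_one_iff.mpr (mul_nonpos_of_nonneg_of_nonpos hθ (by linarith))
          have hs0 : ∀ i, (S₀ i k - z i k) ^ 2 ≤ rk ^ 2 := by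
            intro i
            rw [← sq_abs]
            exact pow_le_pow_left₀ (abs_nonneg _) (hkick i k hk) 2
          have hs : ((S₀ 0 k - z 0 k) ^ 2 + (S₀ 1 k - z 1 k) ^ 2) / 2 ≤ rk ^ 2 := by linarith [hs0 0, hs0 1]
          have hsn : 0 ≤ ((S₀ 0 k - z 0 k) ^ 2 + (S₀ 1 k - z 1 k) ^ 2) / 2 := by positivity
          exact (mul_le_of_le_one_left hsn hw).trans hs
      _ = (Finset.Icc (1 - (K : ℤ) - L) (-(K : ℤ))).card * rk ^ 2 := by rw [Finset.sum_const, nsmul_eq_mul]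
      _ ≤ (L : ℝ) * rk ^ 2 := mul_le_mul_of_nonneg_right hcard (sq_nonneg _)
  -- Minkowski and square roots
  have hm := sqrt_coMovingEnergyOn_add_le (Finset.Icc (1 - (K : ℤ) - L) (-(K : ℤ))) θ' (-(K : ℝ))
    (fun i k _ => z i k) (fun i k _ => S₀ i k - z i k) 0
  have hs₁ : Real.sqrt (coMovingEnergyOn (Finset.Icc (1 - (K : ℤ) - L) (-(K : ℤ))) θ' (-(K : ℝ))
        (fun i k _ => z i k) 0) ≤ Real.sqrt Wn + aK := by
    refine (Real.sqrt_le_sqrt hE₁).trans ((hsqrt_add hWn (sq_nonneg _)).trans ?_)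
    rw [Real.sqrt_sq haK0]
  have hs₂ : Real.sqrt (coMovingEnergyOn (Finset.Icc (1 - (K : ℤ) - L) (-(K : ℤ))) θ' (-(K : ℝ))
        (fun i k _ => S₀ i k - z i k) 0) ≤ Real.sqrt L * rk := by
    refine (Real.sqrt_le_sqrt hE₂).trans ?_
    rw [Real.sqrt_mul (Nat.cast_nonneg _), Real.sqrt_sq hrk]
  rw [hsplit]
  linarith

/-! ## The clause: all blocks at once (L-54e, block level) -/

section Clause

variable {ε ε₀ τ κ₂ : ℝ} {S₀ F₀ B₀ : Fin 2 → ℤ → ℝ} {S F : Fin 2 → ℤ → ℝ → ℝ}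

/-- **THE (B1) CLAUSE AFTER THE HOP.** If the clock-weighted amplitude bound holds on every behind bond (`n ≤ −K`), every
block's edge input is `≤ Ē`, every initial block energy is `≤ V₀` (e.g. from `sqrt_initial_blockEnergy_le` with the
(B1) clause of `H(n)`), and ONE budget `e^{−μτ₁}V₀ + Ē(1−e^{−μτ₁})/μ ≤ a²W′` holds, then the re-centred landing state
satisfies `BehindEnergyClause K θ′ W′`. [cite: Tao2016AveragedNS, §4 (4.3), (4.8), §6.3–6.4 (statement shape); route TaoLadderRungTwoFlat, R54-1 / L-54e (LADDER §54)] -/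
theorem behindEnergyClause_hop_of_pseudoFlow
    (hS : PseudoFlowOnShift shiftSetFlat τ ε₀ (mirrorTable ε ε) 0 κ₂ S₀ F₀ B₀ S F)
    (hε : 0 ≤ ε) (hε₀ : -1 ≤ ε₀) {K : ℕ} {θ' σ τ₁ a Aeff μ Ebar V₀ W' : ℝ} (hθ : 0 ≤ θ')
    (hAeff : 0 ≤ Aeff) (hτ₁ : 0 < τ₁) (hτ₁τ : τ₁ ≤ τ) (hστ : σ * τ₁ = 1) (ha : 0 < a) (hW' : 0 ≤ W')
    (hbd : ∀ t ∈ Ioo 0 τ₁, ∀ n : ℤ, n ≤ -(K : ℤ) →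
      clock ε₀ n * |S 1 n t| ≤ Aeff ∧ clock ε₀ n * |S 0 (n + 1) t| ≤ Aeff)
    (hE : ∀ L : ℕ, 1 ≤ L → ∀ t ∈ Ioo 0 τ₁,
      Real.exp (θ' * ((((1 - (K : ℤ) - L : ℤ)) : ℝ) - (-(K : ℝ) + σ * t))) * |fluxT ε ε₀ S (1 - (K : ℤ) - L - 1) t|
        + Real.exp (θ' * ((((-(K : ℤ)) : ℤ) : ℝ) - (-(K : ℝ) + σ * t))) * |fluxT ε ε₀ S (-(K : ℤ)) t| ≤ Ebar)
    (hV₀ : ∀ L : ℕ, coMovingEnergyOn (Finset.Icc (1 - (K : ℤ) - L) (-(K : ℤ))) θ' (-(K : ℝ)) S 0 ≤ V₀)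
    (hbudget : Real.exp (-μ * τ₁) * V₀ + Ebar * (1 - Real.exp (-μ * τ₁)) / μ ≤ a ^ 2 * W')
    (hμ : 0 < μ) (hμle : μ ≤ σ * θ' - 2 * (1 + ε) * Aeff * Real.sinh (θ' / 2)) :
    BehindEnergyClause K θ' W' (recentre S τ₁ a) := by
  intro L
  rcases Nat.eq_zero_or_pos L with hL | hL
  · rw [hL, behindEnergy_zero_depth]; exact hW'
  · exact behind_hop_of_pseudoFlow hS hε hε₀ hL hθ hAeff hτ₁ hτ₁τ hστ ha
      (fun t ht n hn => hbd t ht n (Finset.mem_Icc.mp hn).2) (hE L hL) hμ hμle (hV₀ L) hbudget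

end Clause

end Summit.NavierStokesRegularity.NavierStokesRegularity.Theorems.HopTube.R54

end
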